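import Summits.BirchSwinnertonDyer.BirchSwinnertonDyer.Theorems.AlignedTransportAtTwoMainConjectureOfRankZeroBSDAtTwoHalfDescentValues
import HarnessLib

/-!
# Route `AlignedTransportAtTwo`, crux C2 `MainConjectureOfRankZeroBSDAtTwo` (stmt-BirchSwinnertonDyer-22298):
# KATO IN HALF-DEGREE COORDINATES, V — A λ-DEFECT IS VISIBLE AT EVERY LAYER: for the defect polynomial `r ≡ (Y−2)^d (mod p)`, `d ≥ 1`,
# `|r(c)| < 1` on the whole disc `|c − 2| < 1` of `ℂ_p`, which contains every real cyclotomic point `ζ + ζ⁻¹`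

HONEST FRAMING (cell `bsd-f1-sign2`, WIDTH-5 attached prover seat `bsd-line-att-p5` gen 52 on line `birth` of the lead `bsd-line-att-p2`;
`--supports` stmt-BirchSwinnertonDyer-22298, closes nothing; BSD is NOT proved by any of this; the crux C2, its verdict «blocked-on
`Rank1Residual.GreenbergMuConjectureIrreducible`» and every registered stub (P / T / Kμ / LimDoor / MuIneqʳ / PFμ⁺) are untouched). THEOREMS ONLY —
pure algebra / `ℂ_p`-norms, any prime `p`; no `def`, no instance, no named fact, no `sorry`. Companion of `…HalfDescentDefect` (the defect polynomial
`r = h_G / h_F` of a Kato pair `F ∣ p^a·G`: monic, `deg r = d`, `r ≡ (Y − 2)^d (mod p)`, `exists_defect_of_dvd_C_pow_mul`) — here its archimedean-free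
size on the `p`-adic unit disc, using the cell's `Rank1Residual.Iwasawa.norm_eval₂_le_max_of_isDistinguishedAt` (`|P(z)| ≤ max(|z|^{deg P}, 1/p)` for
distinguished `P`).
* `isDistinguishedAt_defect_comp_X_add_two`: the shift `r(Z + 2)` is distinguished of degree `d`.
* ★★ `norm_eval₂_defect_lt_one`: `d ≥ 1`, `|c − 2| < 1` ⟹ **`|r(c)| < 1`**.
* `norm_add_inv_sub_two_lt_one`: `|ζ| = 1`, `|ζ − 1| < 1` ⟹ `|ζ + ζ⁻¹ − 2| < 1` (every `p`-power root of unity: EVERY character of EVERY layer, and `ζ = ±1`).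
* ★★★ `norm_eval₂_realCounterpart_lt_of_defect`: `h_G = h_F·r`, `d ≥ 1` ⟹ **`|h_G(ζ+ζ⁻¹)| ≤ |h_F(ζ+ζ⁻¹)|`, strictly where `h_F(ζ+ζ⁻¹) ≠ 0`** — with g51's
  value law `|F(ζ − 1)| = p^{−μ}|ζ + 1|^k|h(ζ + ζ⁻¹)|` (`…HalfDescentTwistZeroValues.norm_tsum_eq_of_twistZero`): the `(μ, k)`-normalised analytic value is
  STRICTLY below the algebraic one at every character as soon as `λ_an − k_an > λ_alg − k_alg`; ONE exact match at ONE character certifies `h_alg = h_an`.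
Memo `Cruxes/MainConjectureOfRankZeroBSDAtTwo/KATO-COORDINATES-att-p5-g52.md`. BSD is not proved by any of this; nothing about any curve is asserted here.

References: L. Washington, GTM 83, §7.1 and Prop. 7.2 [Washington1997]; R. Greenberg, V. Vatsal, Invent. Math. 142 (2000) p. 4 [GreenbergVatsal2000].
-/

set_option linter.dupNamespace false
set_option autoImplicit false

noncomputable section

open scoped Classical

namespace Summit.BirchSwinnertonDyer.BirchSwinnertonDyer.Theorems.AlignedTransportAtTwoHalfDescentDefectLayers

/-! ## §1 The defect is visible at every real cyclotomic point (`ℂ_p`-norm form) -/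

section Layers

open Polynomial Summit.BirchSwinnertonDyer.Rank1Residual.Iwasawa

variable {p : ℕ} [hp : Fact p.Prime]

/-- **The shifted defect `r(Z + 2)` is distinguished**: `r ≡ (Y−2)^d (mod p)`, `r` monic of degree `d` ⟹ `r(Z+2) ≡ Z^d (mod p)` is monic of degree `d`
with lower coefficients in `pℤ_p`. [cite: Washington1997, §7.1 (distinguished polynomials)] -/
theorem isDistinguishedAt_defect_comp_X_add_two {r : ℤ_[p][X]} {d : ℕ} (hrm : r.Monic) (hrd : r.natDegree = d)
    (hred : r.map (IsLocalRing.residue ℤ_[p]) = (X - C 2) ^ d) :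
    (r.comp (X + C 2)).IsDistinguishedAt (IsLocalRing.maximalIdeal ℤ_[p]) ∧ (r.comp (X + C 2)).natDegree = d := by
  rcases subsingleton_or_nontrivial ℤ_[p] with h01 | h01
  · exact absurd h01 (not_subsingleton ℤ_[p])
  have hmon : (r.comp (X + C 2)).Monic := hrm.comp (monic_X_add_C 2) (by rw [natDegree_X_add_C]; exact one_ne_zero)
  have hdeg : (r.comp (X + C 2)).natDegree = d := by
    rw [natDegree_comp_eq_of_mul_ne_zero (by rw [hrm.leadingCoeff, (monic_X_add_C (2 : ℤ_[p])).leadingCoeff, one_pow, one_mul]; exact one_ne_zero),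
      natDegree_X_add_C, mul_one, hrd]
  have hmap : (r.comp (X + C 2)).map (IsLocalRing.residue ℤ_[p]) = X ^ d := by
    rw [Polynomial.map_comp, hred, Polynomial.map_add, Polynomial.map_X, Polynomial.map_C, pow_comp, sub_comp, X_comp, C_comp,
      map_ofNat (IsLocalRing.residue ℤ_[p]) 2, add_sub_cancel_right]
  refine ⟨⟨⟨fun {n} hn => ?_⟩, hmon⟩, hdeg⟩
  rw [← IsLocalRing.residue_eq_zero_iff, ← Polynomial.coeff_map, hmap, Polynomial.coeff_X_pow, if_neg (by rw [hdeg] at hn; omega)]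

/-- ★★ **A POSITIVE-DEGREE DEFECT IS VISIBLE AT EVERY POINT OF THE DISC `|c − 2| < 1` of `ℂ_p`**: `r` monic of degree `d ≥ 1`, `r ≡ (Y−2)^d (mod p)`,
`c ∈ ℂ_p` with `|c − 2| < 1` ⟹ **`|r(c)| < 1`** (indeed `≤ max(|c−2|^d, 1/p)`). The real cyclotomic points `c = ζ + ζ⁻¹` of ALL layers lie in this disc
(`c − 2 = (ζ−1)²/ζ`), as do the `p`-adic integers `c ≡ 2 (mod p)`. [cite: Washington1997, §7.1 (distinguished polynomials) and Prop. 7.2] -/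
theorem norm_eval₂_defect_lt_one {r : ℤ_[p][X]} {d : ℕ} (hrm : r.Monic) (hrd : r.natDegree = d) (hd : 1 ≤ d)
    (hred : r.map (IsLocalRing.residue ℤ_[p]) = (X - C 2) ^ d) {c : ℂ_[p]} (hc : ‖c - 2‖ < 1) :
    ‖r.eval₂ ((algebraMap ℚ_[p] ℂ_[p]).comp (algebraMap ℤ_[p] ℚ_[p])) c‖ < 1 := by
  obtain ⟨hdist, hdeg⟩ := isDistinguishedAt_defect_comp_X_add_two hrm hrd hred
  have hshift : r.eval₂ ((algebraMap ℚ_[p] ℂ_[p]).comp (algebraMap ℤ_[p] ℚ_[p])) c =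
      (r.comp (X + C 2)).eval₂ ((algebraMap ℚ_[p] ℂ_[p]).comp (algebraMap ℤ_[p] ℚ_[p])) (c - 2) := by
    rw [eval₂_comp, eval₂_add, eval₂_X, eval₂_C, map_ofNat, sub_add_cancel]
  rw [hshift]
  refine (norm_eval₂_le_max_of_isDistinguishedAt hdist hc.le).trans_lt (max_lt ?_ (inv_prime_pos_and_lt_one (p := p)).2)
  rw [hdeg]
  exact pow_lt_one₀ (norm_nonneg _) hc (by omega)

/-- **Real cyclotomic points lie in the disc**: `ζ ∈ ℂ_p` with `|ζ| = 1`, `|ζ − 1| < 1` (every `p`-power root of unity) ⟹ `|ζ + ζ⁻¹ − 2| < 1`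
(`ζ + ζ⁻¹ − 2 = (ζ − 1)²·ζ⁻¹`). [folklore] -/
theorem norm_add_inv_sub_two_lt_one {ζ : ℂ_[p]} (hζ1 : ‖ζ‖ = 1) (hζ : ‖ζ - 1‖ < 1) : ‖ζ + ζ⁻¹ - 2‖ < 1 := by
  have hζ0 : ζ ≠ 0 := fun h0 ↦ by rw [h0, norm_zero] at hζ1; exact zero_ne_one hζ1
  have hid : ζ + ζ⁻¹ - 2 = (ζ - 1) ^ 2 * ζ⁻¹ := by field_simp; ring
  rw [hid, norm_mul, norm_inv, hζ1, inv_one, mul_one, norm_pow]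
  exact pow_lt_one₀ (norm_nonneg _) hζ (by norm_num)

/-- ★★★ **A λ-DEFECT IS VISIBLE AT EVERY LAYER AT ONCE.** `h_G = h_F·r` with `r` the defect (monic, degree `d ≥ 1`, `≡ (Y−2)^d (mod p)`), `ζ ∈ ℂ_p` with
`|ζ| = 1`, `|ζ − 1| < 1` (ANY `p`-power root of unity: every character of every layer, and `ζ = ±1`). Then
**`|h_G(ζ + ζ⁻¹)| ≤ |h_F(ζ + ζ⁻¹)|`, STRICTLY if `h_F(ζ + ζ⁻¹) ≠ 0`** — so by g51's value law `|F(ζ−1)| = p^{−μ}|ζ+1|^k|h(ζ+ζ⁻¹)|` the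
`(μ, k)`-normalised analytic value is strictly below the algebraic one at EVERY character as soon as `λ_an − k_an > λ_alg − k_alg`; equality at ONE
character certifies `h_F = h_G`. [cite: Washington1997, §7.1 and Prop. 7.2] [cite: GreenbergVatsal2000, p. 4] -/
theorem norm_eval₂_realCounterpart_lt_of_defect {h₁ h₂ r : ℤ_[p][X]} {d : ℕ} (hr : h₂ = h₁ * r) (hrm : r.Monic) (hrd : r.natDegree = d) (hd : 1 ≤ d)
    (hred : r.map (IsLocalRing.residue ℤ_[p]) = (X - C 2) ^ d) {ζ : ℂ_[p]} (hζ1 : ‖ζ‖ = 1) (hζ : ‖ζ - 1‖ < 1) :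
    ‖h₂.eval₂ ((algebraMap ℚ_[p] ℂ_[p]).comp (algebraMap ℤ_[p] ℚ_[p])) (ζ + ζ⁻¹)‖ ≤
        ‖h₁.eval₂ ((algebraMap ℚ_[p] ℂ_[p]).comp (algebraMap ℤ_[p] ℚ_[p])) (ζ + ζ⁻¹)‖ ∧
      (h₁.eval₂ ((algebraMap ℚ_[p] ℂ_[p]).comp (algebraMap ℤ_[p] ℚ_[p])) (ζ + ζ⁻¹) ≠ 0 →
        ‖h₂.eval₂ ((algebraMap ℚ_[p] ℂ_[p]).comp (algebraMap ℤ_[p] ℚ_[p])) (ζ + ζ⁻¹)‖ <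
          ‖h₁.eval₂ ((algebraMap ℚ_[p] ℂ_[p]).comp (algebraMap ℤ_[p] ℚ_[p])) (ζ + ζ⁻¹)‖) := by
  have hlt := norm_eval₂_defect_lt_one hrm hrd hd hred (norm_add_inv_sub_two_lt_one hζ1 hζ)
  rw [hr, eval₂_mul, norm_mul]
  refine ⟨mul_le_of_le_one_right (norm_nonneg _) hlt.le, fun hne ↦ ?_⟩
  exact mul_lt_of_lt_one_right (norm_pos_iff.mpr hne) hlt

end Layers

end Summit.BirchSwinnertonDyer.BirchSwinnertonDyer.Theorems.AlignedTransportAtTwoHalfDescentDefectLayers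

end
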